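import Literature.MathematicalPhysics.QuantumFieldTheory.Balaban1983to89.B10Assembly

/-!
# `Summit.QuantumFields.Balaban3D.Proofs.SectAFirstStep` — [Balaban1985UV3] Sect. A at k = 0: the base (1) ⇒ (41)₀ ∧ (47)₀
# (`LeafSystem.step0`, `noInt0`, `Rm_zero`) for ANY tower whose step-0 data are the printed ones — lane `pub-balaban3d`,
# seat p4 (PLAN.md §3.1 l.138 «targets `LeafSystem.step0` algebraic part»)

HONEST FRAMING (lane PLAN.md §0, binding).  T. Bałaban, *Ultraviolet stability of three-dimensional lattice pure gauge
field theories*, Commun. Math. Phys. **102** (1985) 255–275 [Balaban1985UV3] proves UV-stability bounds (5) p. 256 for the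
Wilson lattice approximation of pure Yang–Mills in d = 3 on a finite torus.  NOT a continuum limit, NOT infinite volume,
NOT a mass gap, NOT d = 4, NOT the Clay problem.  This file asserts NOTHING of the paper: it is [folklore] exponent
bookkeeping, kernel-checked, over the 4D cell's abstract carrier `B10.TowerRun` (LQB =
`Literature.MathematicalPhysics.QuantumFieldTheory.Balaban1983to89`), written so that the lane's concrete d = 3 tower
(`run3`, seat p1, PLAN §3.1) discharges the three k = 0 fields of `B10Assembly.LeafSystem` by ONE structure instance.

WHAT IS PRINTED (journal page = PDF page + 254; read on the renders `…/1985-cmp102-uv-stability-3d/…-p002-x2.png`,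
`…-p011-x2.png`, `…-p012-x2.png`, `…-p013-x2.png`):
* (1) p. 256 L2–4: «We start with the action density  ρ₀(U) = exp[−(1/g₀²)A(U) − E],  (1)»;
* (41) p. 266 L19–21 / (47) p. 267 L16–17: the inductive inequalities, whose k = 0 instance has NO history sum (no Ω_j,
  j < 0), NO interaction terms ((43) p. 266: «Σ_{j=1}^{k}» is empty), NO Z-terms and NO remainder («Σ_{j=0}^{k−1}» empty),
  and E₀ = E ((36) p. 265 L21 «E₁ = E − E^{(0)}», (64) p. 273 «E_k = Σ_{j=k}^{K−1} E^{(j)}»);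
* LQB types this base as the LEAF `B10.Step0Printed T := Ineq41 T 0 ∧ Ineq47 T 0` (B10.lean l. 454, docstring: «left as a
  leaf (it is an identity about the objects the carrier only names)») and `B10LargeField.NoInteraction0`, consumed as the
  fields `step0`, `noInt0`, `Rm_zero` of `B10Assembly.LeafSystem` (l. 265, 267, 290).

WHAT THIS FILE PROVES (no `sorry`, axioms standard):
* §1 `Step0Data T` — the k = 0 CONTRACT a tower built from (1) satisfies (five clauses, each the printed reading of one
  token of (1)/(41)₀/(47)₀), and `step0_of_data : Step0Data T → B10.Step0Printed T`, `noInt0_of_data`, `rm_zero_of_data`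
  — so `LeafSystem.step0/noInt0/Rm_zero` for the concrete tower are `(step0_of_data D)`, … once p1 exhibits `D`.
* §2 `step0Data_of_exp` — the contract holds for the canonical k = 0 history functional `LF 0 U F = exp (F (triv 0))`
  (one history, no characteristic function: (41)₀ must hold for the everywhere-positive ρ₀).
NOT HERE: the tower `run3` itself (p1, `Carriers/Run.lean`); the k = 0 STEP leaves (22)/(24)/(33)/(35) (`StepLeaves T 0`:
`bound55` is this seat's `…Proofs.SectABound55`, the others p5/p6); anything of Sect. C/D.
-/

namespace Summit.QuantumFields.Balaban3D.Proofs.SectAFirstStep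

open Literature.MathematicalPhysics.QuantumFieldTheory.Balaban1983to89
open Literature.MathematicalPhysics.QuantumFieldTheory.Balaban1983to89.B10 (TowerRun Ineq41 Ineq47 Step0Printed)
open Literature.MathematicalPhysics.QuantumFieldTheory.Balaban1983to89.B10LargeField (NoInteraction0)

/-! ## §1 The k = 0 contract and (1) ⇒ (41)₀ ∧ (47)₀ -/

/-- THE k = 0 CONTRACT of a tower `T : B10.TowerRun` built from the printed start (1) p. 256 = PDF 2 L2–4 «ρ₀(U) =
exp[−(1/g₀²)A(U) − E]»: (i) `lf_triv` — at k = 0 the history functional of (41) has no sum over {Ω_j}_{j<0} and no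
integration, so the term of the trivial history `T.triv 0` is (at most) the whole functional: `exp (F (triv 0)) ≤ LF 0 U F`
(equality for the canonical choice `LF 0 U F = exp (F (triv 0))`, §2); (ii) `rho_zero` — (1) itself, with `(T.g 0)⁻¹ ^ 2 *
T.wilsonBG 0 U = (1/g₀²)A(U)` (at k = 0, η = L⁰ = 1 and U₀(U) = U: «U_k(U) is the minimal configuration … determined by the
configuration U on T₁^{(k)}», p. 256 L35–36, is U itself when no average is taken) and `T.Ecst 0 = E₀ = E` ((36) p. 265
«E₁ = E − E^{(0)}», (64) p. 273); (iii) `pint_zero` — (43) p. 266: the interaction sum «Σ_{j=1}^{k} Σ_{Y_j} 𝒫_j(Y_j, U_k)» is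
empty at k = 0 (= `B10LargeField.NoInteraction0`); (iv) `rm_zero` — the remainder sum «Σ_{j=0}^{k−1} O((L^jε)^{3+κ₀})|T₁^{(j)}|»
of (41)/(47) is empty at k = 0; (v) `chi_le_one` — χ of (4) p. 256 is a characteristic function.  Only NAMES the printed
readings; a `Prop`-valued structure (no data). [folklore] -/
structure Step0Data (T : TowerRun) : Prop where
  /-- (41)₀ has no history sum: the trivial-history term is dominated by the k = 0 history functional -/
  lf_triv : ∀ (U : T.Cfg 0) (F : T.Hist 0 → ℝ), Real.exp (F (T.triv 0)) ≤ T.LF 0 U F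
  /-- (1) p. 256: ρ₀(U) = exp[−(1/g₀²)A(U) − E], E = E₀ -/
  rho_zero : ∀ U : T.Cfg 0, T.ρ 0 U = Real.exp (-((T.g 0)⁻¹ ^ 2 * T.wilsonBG 0 U) - T.Ecst 0)
  /-- (43) p. 266: no interaction terms at k = 0 -/
  pint_zero : ∀ (h : T.Hist 0) (U : T.Cfg 0), T.Pint 0 h U = 0
  /-- (41)/(47): the remainder sum is empty at k = 0 -/
  rm_zero : T.Rm 0 = 0
  /-- (4) p. 256: χ is a characteristic function, χ ≤ 1 -/
  chi_le_one : ∀ U : T.Cfg 0, T.χ 0 U ≤ 1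

variable {T : TowerRun}

/-- (43) p. 266 at k = 0 is the `LeafSystem` field `noInt0` (`B10LargeField.NoInteraction0`). [folklore] -/
theorem noInt0_of_data (D : Step0Data T) : NoInteraction0 T := D.pint_zero

/-- The empty remainder sum at k = 0 is the `LeafSystem` field `Rm_zero` (`T.Rm 0 ≤ 0`). [folklore] -/
theorem rm_zero_of_data (D : Step0Data T) : T.Rm 0 ≤ 0 := le_of_eq D.rm_zero

/-- **(41) at k = 0 from (1)**: `ρ₀(U) = exp[−(1/g₀²)A(U) − E] ≤ LF₀(U)(h ↦ −mainT₀(h, U) + Pint₀ − E₀ + Zterm₀(h) + Rm₀)`,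
because the exponent at the trivial history IS `−(1/g₀²)A(U) − E` (`T.mainT_triv`, `T.Zterm_triv`, no interaction, no
remainder) and that term is dominated by `LF₀` (`lf_triv`).  Re-derived bookkeeping. [cite: Balaban1985UV3, (1) p.256 + (41) p.266] -/
theorem ineq41_zero_of_data (D : Step0Data T) : Ineq41 T 0 := by
  intro U
  rw [D.rho_zero U]
  refine le_trans (le_of_eq ?_) (D.lf_triv U _)
  rw [T.mainT_triv, D.pint_zero, T.Zterm_triv, D.rm_zero]
  ring_nf

/-- **(47) at k = 0 from (1)**: `χ₀(U)·exp[−(1/g₀²)A(U) + 0 − E₀ − 0] ≤ ρ₀(U)` since `χ ≤ 1`.  Re-derived bookkeeping.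
[cite: Balaban1985UV3, (1) p.256 + (47) p.267] -/
theorem ineq47_zero_of_data (D : Step0Data T) : Ineq47 T 0 := by
  intro U
  rw [D.rho_zero U, T.mainT_triv, D.pint_zero, D.rm_zero]
  have h1 := D.chi_le_one U
  have hexp : 0 < Real.exp (-((T.g 0)⁻¹ ^ 2 * T.wilsonBG 0 U) - T.Ecst 0) := Real.exp_pos _
  calc T.χ 0 U * Real.exp (-((T.g 0)⁻¹ ^ 2 * T.wilsonBG 0 U) + 0 - T.Ecst 0 - 0)
      = T.χ 0 U * Real.exp (-((T.g 0)⁻¹ ^ 2 * T.wilsonBG 0 U) - T.Ecst 0) := by ring_nf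
    _ ≤ 1 * Real.exp (-((T.g 0)⁻¹ ^ 2 * T.wilsonBG 0 U) - T.Ecst 0) :=
        mul_le_mul_of_nonneg_right h1 hexp.le
    _ = _ := one_mul _

/-- **`LeafSystem.step0` for any tower with the printed k = 0 data**: `Step0Data T → B10.Step0Printed T`
(= (41)₀ ∧ (47)₀).  Re-derived bookkeeping; the concrete tower of the lane discharges `LeafSystem.step0` by
`step0_of_data D`. [cite: Balaban1985UV3, (1) p.256] -/
theorem step0_of_data (D : Step0Data T) : Step0Printed T :=
  ⟨ineq41_zero_of_data D, ineq47_zero_of_data D⟩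

/-! ## §2 The canonical k = 0 history functional satisfies the contract -/

/-- If the tower's k = 0 history functional is the canonical one — ONE history and no characteristic function,
`LF 0 U F = exp (F (triv 0))` (p. 266: at k = 0 the list {Ω_j, Λ_j, Z_j, V_j}_{j<k} of (38)–(41) is empty) — and the other four
clauses hold, the contract holds (clause (i) with equality). [folklore] -/
theorem step0Data_of_exp
    (hLF : ∀ (U : T.Cfg 0) (F : T.Hist 0 → ℝ), T.LF 0 U F = Real.exp (F (T.triv 0)))
    (hρ : ∀ U : T.Cfg 0, T.ρ 0 U = Real.exp (-((T.g 0)⁻¹ ^ 2 * T.wilsonBG 0 U) - T.Ecst 0))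
    (hP : ∀ (h : T.Hist 0) (U : T.Cfg 0), T.Pint 0 h U = 0) (hR : T.Rm 0 = 0)
    (hχ : ∀ U : T.Cfg 0, T.χ 0 U ≤ 1) : Step0Data T where
  lf_triv U F := le_of_eq (hLF U F).symm
  rho_zero := hρ
  pint_zero := hP
  rm_zero := hR
  chi_le_one := hχ

/-- Sanity instance (non-vacuity of the contract): LQB's trivial witness tower `B10Assembly.trivRun K` (ρ ≡ χ ≡ 1, all
terms 0, `LF k U F = exp (F ())`) satisfies `Step0Data`. [folklore] -/
theorem step0Data_trivRun (K : ℕ) : Step0Data (B10Assembly.trivRun K) :=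
  step0Data_of_exp (fun _ _ => rfl) (fun _ => by simp [B10Assembly.trivRun]) (fun _ _ => rfl) rfl
    (fun _ => le_rfl)

end Summit.QuantumFields.Balaban3D.Proofs.SectAFirstStep
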